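import Literature.NumberTheory.Automorphic.ArchimedeanApplyFreeCongr
import Literature.NumberTheory.Automorphic.RealMatrixGroupsExpOpen
import Literature.Analysis.Calculus.ExpMulExpLocalLog
import HarnessLib

/-!
# The exponential chart of a linear real group and its left-invariant frame in coordinates

Topic `NumberTheory/Automorphic`; a sequel of `ArchimedeanApplyFreeCongr` (the local Lie-subgroup
property of `exp 𝔤`) and of `Literature.Analysis.Calculus.ExpMulExpLocalLog`. Let
`H : RealMatrixGroup A N` be a linear real group over a finite-dimensional coefficient algebra,
`𝔤 = H.lie` (of dimension `d`), and fix linear coordinates `x ↦ ∑ x_p b_p : ℝ^d ≃ 𝔤`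
(`lieBasis`, `lieCoord`, `lieGen p = b_p`). The exponential chart `expCoord x = exp (∑ x_p b_p)`
carries functions `ψ` on `H` (or `h ↦ ψ (g · ι h)` for `ψ` on a group `G` receiving `H` through
`ι`, `pullAt`) to functions on `ℝ^d`, and this file constructs the **coordinate expression of the
left-invariant vector fields**:

* `chartFlow p (x, s) = coords (π (log (exp (∑ x_q b_q) · exp (s b_p))))` (`log = localLog`, the
  local inverse of the matrix exponential at `0`; `π` a linear retraction onto `𝔤`) and the frame
  `chartFrame p x = ∂_s|₀ chartFlow p (x, s)` — it involves NO base point (right derivatives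
  commute with left translations), which is what makes every constant of the `L²`-analysis of
  the sequels uniform in the base point;
* `expCoord_chartFlow` — the flow identity `expCoord (chartFlow p (x, s)) = expCoord x · exp (s b_p)`
  for small `x, s` (from `eventually_localLog_exp_mul_exp_mem`: `log (exp Y exp Z) ∈ 𝔤` for small
  `Y, Z ∈ 𝔤`, no Baker–Campbell–Hausdorff series);
* `exists_chartRadius`, `chartRadius`, `contDiffOn_chartFrame`,
  `fderiv_comp_expCoord_chartFrame` — **a radius `r > 0` such that on the ball `‖x‖ < r` every
  `V_p = chartFrame p` is smooth and `D(ψ ∘ expCoord)(x)[V_p(x)] = (b_p ψ)(expCoord x)`** for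
  every `ψ` smooth along the exponential (`IsArchSmooth`);
* `chartFrame_zero` — `V_p(0) = e_p` (so the `V_p` are a frame near `0`);
* `frameWord`, `frameWord_comp_expCoord_eqOn`, `frameWord_pullAt_eqOn` — words
  `V_{p₁} ⋯ V_{pₖ}` applied to `x ↦ ψ (g ι(expCoord x))` are the chart expressions of the
  iterated Lie derivatives `b_{p₁} ⋯ b_{pₖ} ψ` on the ball.

Everything here is proved; the definitions are the coordinates, the chart, the flow, the frame,
the words and the pull-back `pullAt`. This is the geometric input of the interior estimate for
Lie derivatives of automorphic forms (Borel–Jacquet 1979, 4.3 (ii)) in the sequels.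

## References

* A. W. Knapp, *Lie Groups Beyond an Introduction*, 2nd ed. (2002), I.§10, Prop. 1.86–1.89
  [Knapp2002].
* B. C. Hall, *Lie Groups, Lie Algebras, and Representations*, 2nd ed. (2015), Cor. 3.44–3.45 and
  Thm. 5.20 [Hall2015].
* A. Borel, H. Jacquet, *Automorphic forms and automorphic representations*, Proc. Sympos. Pure
  Math. 33.1 (1979), §1.1 and §1.5 [BorelJacquetCorvallis1979].
-/

-- Mathlib idiom (Mathlib/Algebra/Lie/OfAssociative.lean); needed to mention Lie subalgebras of matrix algebras
attribute [local instance 100] LieRing.ofAssociativeRing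

noncomputable section

open scoped MatrixGroups Matrix ContDiff Topology
open Filter Set Metric Literature.Analysis.Calculus

namespace Literature.NumberTheory.Automorphic

variable {A : Type*} [NormedCommRing A] [NormedAlgebra ℝ A] [NormedAlgebra ℚ A] [CompleteSpace A]
  [StarRing A] {N : Type*} [Fintype N] [DecidableEq N] (H : RealMatrixGroup A N)

namespace RealMatrixGroup

/-! ### Linear coordinates on `𝔤` -/

/-- The dimension `d = dim_ℝ 𝔤` of the Lie algebra of `H`. [folklore] -/
def lieDim : ℕ := Module.finrank ℝ H.lie.toSubmodule

/-- A linear retraction `𝔤𝔩(N, A) → 𝔤` (a choice from `exists_retraction_lie`). [folklore] -/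
def lieRetract : Matrix N N A →ₗ[ℝ] H.lie.toSubmodule := Classical.choose H.exists_retraction_lie

/-- The retraction is the identity on `𝔤`. [folklore] -/
theorem lieRetract_apply_coe (Y : H.lie.toSubmodule) : H.lieRetract Y = Y :=
  Classical.choose_spec H.exists_retraction_lie Y

variable [FiniteDimensional ℝ A]

/-- A basis `(b_p)_{p < d}` of `𝔤` over `ℝ` (`Module.finBasis`). [folklore] -/
def lieBasis : Module.Basis (Fin H.lieDim) ℝ H.lie.toSubmodule := Module.finBasis ℝ _

/-- The linear coordinates `x ↦ ∑ x_p b_p : ℝ^d ≃ 𝔤`. [folklore] -/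
def lieCoord : (Fin H.lieDim → ℝ) ≃ₗ[ℝ] H.lie.toSubmodule := H.lieBasis.equivFun.symm

/-- The basis vector `b_p` as an element of the Lie algebra `H.lie`. [folklore] -/
def lieGen (p : Fin H.lieDim) : H.lie := ⟨(H.lieBasis p : Matrix N N A), (H.lieBasis p).2⟩

/-- `lieCoord (Pi.single p 1) = b_p`. [folklore] -/
theorem lieCoord_single (p : Fin H.lieDim) : H.lieCoord (Pi.single p 1) = H.lieBasis p := by
  simp [lieCoord, Module.Basis.equivFun_symm_apply, Pi.single_apply]

/-- The exponential chart `x ↦ exp (∑ x_p b_p) ∈ H`. Knapp 2002, I.§10. [folklore] -/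
def expCoord (x : Fin H.lieDim → ℝ) : H.carrier :=
  H.expMem ⟨(H.lieCoord x : Matrix N N A), (H.lieCoord x).2⟩

/-- `expCoord 0 = 1`. [folklore] -/
theorem expCoord_zero : H.expCoord 0 = 1 := by
  simp only [expCoord, map_zero]
  exact H.expMem_mk_zero

/-- The matrix of `expCoord x` is `exp (∑ x_p b_p)`. [folklore] -/
theorem coe_expCoord (x : Fin H.lieDim → ℝ) :
    ((H.expCoord x : GL N A) : Matrix N N A) = NormedSpace.exp ((H.lieCoord x : Matrix N N A)) := rfl


/-! ### The flow of `b_p` and the left-invariant frame in the exponential chart -/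

set_option backward.isDefEq.respectTransparency false in
open scoped Matrix.Norms.Operator in
/-- The flow of right multiplication by `exp (s b_p)` read in the exponential chart:
`Φ_p(x, s) = coords (π (log (exp (∑ x_q b_q) · exp (s b_p))))`, with `log = localLog` the local
inverse of the matrix exponential at `0` and `π` a linear retraction onto `𝔤`. For `x` and `s`
small, `exp (lieCoord (Φ_p (x, s))) = exp (∑ x_q b_q) exp (s b_p)` (`expCoord_chartFlow`).
Hall 2015, Thm. 5.20; Knapp 2002, I.§10. [folklore] -/
def chartFlow (p : Fin H.lieDim) (z : (Fin H.lieDim → ℝ) × ℝ) : Fin H.lieDim → ℝ :=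
  H.lieCoord.symm (H.lieRetract (localLog
    (NormedSpace.exp ((H.lieCoord z.1 : Matrix N N A)) *
      NormedSpace.exp (z.2 • ((H.lieBasis p : H.lie.toSubmodule) : Matrix N N A)))))

/-- **The left-invariant frame in the exponential chart**: `V_p(x) = ∂_s|₀ Φ_p(x, s)`, the
coordinate expression of the left-invariant vector field of `b_p` (it does not depend on any base
point: right derivatives commute with left translations). Knapp 2002, I.§10. [folklore] -/
def chartFrame (p : Fin H.lieDim) (x : Fin H.lieDim → ℝ) : Fin H.lieDim → ℝ :=
  deriv (fun s : ℝ ↦ H.chartFlow p (x, s)) 0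

set_option backward.isDefEq.respectTransparency false in
open scoped Matrix.Norms.Operator in
/-- The coordinate map `x ↦ ∑ x_p b_p ∈ 𝔤𝔩(N, A)` as a continuous linear map. [folklore] -/
def lieCoordL : (Fin H.lieDim → ℝ) →L[ℝ] Matrix N N A :=
  H.lie.toSubmodule.subtypeL.comp (LinearMap.toContinuousLinearMap H.lieCoord.toLinearMap)

set_option backward.isDefEq.respectTransparency false in
open scoped Matrix.Norms.Operator in
/-- `lieCoordL x = ↑(lieCoord x)`. [folklore] -/
theorem lieCoordL_apply (x : Fin H.lieDim → ℝ) : H.lieCoordL x = (H.lieCoord x : Matrix N N A) := rfl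

set_option backward.isDefEq.respectTransparency false in
open scoped Matrix.Norms.Operator in
/-- `Φ_p` is smooth wherever `log` is smooth at `exp (∑ x_q b_q) exp (s b_p)`. [folklore] -/
theorem contDiffAt_chartFlow (p : Fin H.lieDim) {z : (Fin H.lieDim → ℝ) × ℝ}
    (hz : ContDiffAt ℝ ω localLog
      (NormedSpace.exp ((H.lieCoord z.1 : Matrix N N A)) *
        NormedSpace.exp (z.2 • ((H.lieBasis p : H.lie.toSubmodule) : Matrix N N A)))) :
    ContDiffAt ℝ ∞ (H.chartFlow p) z := by
  have hin : ContDiff ℝ ∞ fun z : (Fin H.lieDim → ℝ) × ℝ ↦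
      NormedSpace.exp ((H.lieCoord z.1 : Matrix N N A)) *
        NormedSpace.exp (z.2 • ((H.lieBasis p : H.lie.toSubmodule) : Matrix N N A)) := by
    refine (contDiff_exp.comp ?_).mul (contDiff_exp.comp (contDiff_snd.smul contDiff_const))
    exact H.lieCoordL.contDiff.comp contDiff_fst
  have hout : ContDiff ℝ ∞ fun Y : Matrix N N A ↦ H.lieCoord.symm (H.lieRetract Y) := by
    have h1 : ContDiff ℝ ∞ fun Y : Matrix N N A ↦ H.lieRetract Y :=
      (LinearMap.toContinuousLinearMap H.lieRetract).contDiff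
    exact (LinearMap.toContinuousLinearMap H.lieCoord.symm.toLinearMap).contDiff.comp h1
  exact hout.contDiffAt.comp z ((hz.of_le le_top).comp z hin.contDiffAt)

set_option backward.isDefEq.respectTransparency false in
open scoped Matrix.Norms.Operator in
/-- **The flow identity**: if `Y = ∑ x_q b_q` and `Z = s b_p` are so small that
`log (exp Y exp Z) ∈ 𝔤` and `exp (log (exp Y exp Z)) = exp Y exp Z`
(`Literature.Analysis.Calculus.eventually_localLog_exp_mul_exp_mem`), then
`expCoord (Φ_p (x, s)) = expCoord x · exp (s b_p)` in `H`. Hall 2015, Thm. 5.20. [folklore] -/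
theorem expCoord_chartFlow (p : Fin H.lieDim) {x : Fin H.lieDim → ℝ} {s : ℝ}
    (hmem : localLog (NormedSpace.exp ((H.lieCoord x : Matrix N N A)) *
        NormedSpace.exp (s • ((H.lieBasis p : H.lie.toSubmodule) : Matrix N N A))) ∈
      H.lie.toSubmodule)
    (hexp : NormedSpace.exp (localLog (NormedSpace.exp ((H.lieCoord x : Matrix N N A)) *
        NormedSpace.exp (s • ((H.lieBasis p : H.lie.toSubmodule) : Matrix N N A)))) =
      NormedSpace.exp ((H.lieCoord x : Matrix N N A)) *
        NormedSpace.exp (s • ((H.lieBasis p : H.lie.toSubmodule) : Matrix N N A))) :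
    H.expCoord (H.chartFlow p (x, s)) = H.expCoord x * H.expMem (s • H.lieGen p) := by
  set W : Matrix N N A := localLog (NormedSpace.exp ((H.lieCoord x : Matrix N N A)) *
    NormedSpace.exp (s • ((H.lieBasis p : H.lie.toSubmodule) : Matrix N N A))) with hW
  have hret : H.lieRetract W = ⟨W, hmem⟩ := H.lieRetract_apply_coe ⟨W, hmem⟩
  have hflow : H.lieCoord (H.chartFlow p (x, s)) = ⟨W, hmem⟩ := by
    simp only [chartFlow, LinearEquiv.apply_symm_apply, ← hW, hret]
  refine Subtype.ext (Units.ext ?_)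
  change NormedSpace.exp ((H.lieCoord (H.chartFlow p (x, s)) : Matrix N N A)) =
    NormedSpace.exp ((H.lieCoord x : Matrix N N A)) *
      NormedSpace.exp (((s • H.lieGen p : H.lie) : Matrix N N A))
  rw [hflow]
  exact hexp

set_option backward.isDefEq.respectTransparency false in
open scoped Matrix.Norms.Operator in
/-- `Φ_p (x, 0) = x` as soon as `log (exp Y) = Y` at `Y = ∑ x_q b_q`. [folklore] -/
theorem chartFlow_zero (p : Fin H.lieDim) {x : Fin H.lieDim → ℝ}
    (hx : localLog (NormedSpace.exp ((H.lieCoord x : Matrix N N A))) = (H.lieCoord x : Matrix N N A)) :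
    H.chartFlow p (x, 0) = x := by
  simp only [chartFlow, zero_smul, NormedSpace.exp_zero, mul_one, hx, lieRetract_apply_coe,
    LinearEquiv.symm_apply_apply]

set_option backward.isDefEq.respectTransparency false in
open scoped Matrix.Norms.Operator in
/-- **A radius of validity for the exponential chart of `H`.** There is `r > 0` such that, on the
ball `‖x‖ < r` of the coordinate space `ℝ^d`:
(i) every coordinate vector field `V_p` of the left-invariant frame is smooth;
(ii) for every function `ψ` on `H` smooth along the exponential (`IsArchSmooth`), the derivative of
its chart expression `x ↦ ψ (expCoord x)` along `V_p` is the chart expression of the Lie derivative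
`b_p ψ`: `D(ψ ∘ expCoord)(x)[V_p(x)] = (b_p ψ)(expCoord x)`.
Proof: near `0` the local logarithm is smooth, `log ∘ exp = id`, and `log (exp Y exp Z) ∈ 𝔤` for
small `Y, Z ∈ 𝔤` (the local Lie-subgroup property `eventually_localLog_exp_mul_exp_mem`, no
Baker–Campbell–Hausdorff series), so that `expCoord (Φ_p (x, s)) = expCoord x · exp (s b_p)` and
the chain rule applies. Knapp 2002, I.§10, Prop. 1.86–1.89; Hall 2015, Thm. 5.20, Cor. 3.44–3.45;
Borel–Jacquet 1979, §1.5. [cite: Hall2015, Thm. 5.20] -/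
theorem exists_chartRadius :
    ∃ r > (0 : ℝ),
      (∀ p, ContDiffOn ℝ ∞ (H.chartFrame p) (ball 0 r)) ∧
      ∀ (p : Fin H.lieDim) (ψ : H.carrier → ℂ), IsArchSmooth (MonoidHom.id H.carrier) ψ →
        ∀ x ∈ ball (0 : Fin H.lieDim → ℝ) r,
          fderiv ℝ (fun y ↦ ψ (H.expCoord y)) x (H.chartFrame p x) =
            lieDeriv (MonoidHom.id H.carrier) (H.lieGen p) ψ (H.expCoord x) := by
  -- (a) `log ∘ exp = id` near `0`
  have hleft : ∀ᶠ Y in 𝓝 (0 : Matrix N N A), localLog (NormedSpace.exp Y) = Y :=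
    HasStrictFDerivAt.eventually_left_inverse _
  -- (b) `log (exp Y exp Z) ∈ 𝔤` with `exp log = id` there, for small `Y, Z ∈ 𝔤`
  have hpair := eventually_localLog_exp_mul_exp_mem H.closedComplemented_lie
    H.exp_mul_mul_exp_neg_mem_lie
  -- (c) `log` is smooth at `exp Y exp Z` for small `Y, Z`
  have hsm : ∀ᶠ q in 𝓝 (0 : Matrix N N A × Matrix N N A),
      ContDiffAt ℝ ω localLog (NormedSpace.exp q.1 * NormedSpace.exp q.2) := by
    have hc : Continuous fun q : Matrix N N A × Matrix N N A ↦
        NormedSpace.exp q.1 * NormedSpace.exp q.2 :=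
      (contDiff_exp (m := 0)).continuous.fst'.mul (contDiff_exp (m := 0)).continuous.snd'
    have ht : Tendsto (fun q : Matrix N N A × Matrix N N A ↦
        NormedSpace.exp q.1 * NormedSpace.exp q.2) (𝓝 0) (𝓝 1) := by
      have := hc.tendsto 0
      simpa using this
    exact ht.eventually ((contDiffAt_localLog (m := ω)).eventually (by simp))
  obtain ⟨δ₁, hδ₁, h1⟩ := Metric.eventually_nhds_iff.mp hleft
  obtain ⟨δ₂, hδ₂, h2⟩ := Metric.eventually_nhds_iff.mp (hpair.and hsm)
  set δ : ℝ := min δ₁ δ₂ with hδ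
  have hδ0 : 0 < δ := lt_min hδ₁ hδ₂
  have h1' : ∀ Y : Matrix N N A, ‖Y‖ < δ → localLog (NormedSpace.exp Y) = Y := fun Y hY ↦
    h1 (by rw [dist_zero_right]; exact hY.trans_le (min_le_left _ _))
  have h2' : ∀ Y Z : Matrix N N A, ‖Y‖ < δ → ‖Z‖ < δ →
      (Y ∈ H.lie.toSubmodule → Z ∈ H.lie.toSubmodule →
        localLog (NormedSpace.exp Y * NormedSpace.exp Z) ∈ H.lie.toSubmodule ∧
          NormedSpace.exp (localLog (NormedSpace.exp Y * NormedSpace.exp Z)) =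
            NormedSpace.exp Y * NormedSpace.exp Z) ∧
      ContDiffAt ℝ ω localLog (NormedSpace.exp Y * NormedSpace.exp Z) := by
    intro Y Z hY hZ
    have : dist (Y, Z) (0 : Matrix N N A × Matrix N N A) < δ₂ := by
      rw [dist_zero_right, Prod.norm_def]
      exact (max_lt hY hZ).trans_le (min_le_right _ _)
    exact h2 this
  -- the radius
  set K : ℝ := ‖H.lieCoordL‖ with hK
  have hK0 : 0 ≤ K := norm_nonneg _
  set r : ℝ := δ / (K + 1) with hr
  have hr0 : 0 < r := div_pos hδ0 (by linarith)
  have hxδ : ∀ x ∈ ball (0 : Fin H.lieDim → ℝ) r, ‖(H.lieCoord x : Matrix N N A)‖ < δ := by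
    intro x hx
    rw [mem_ball_zero_iff] at hx
    rw [← lieCoordL_apply]
    calc ‖H.lieCoordL x‖ ≤ K * ‖x‖ := H.lieCoordL.le_opNorm x
      _ ≤ K * r := mul_le_mul_of_nonneg_left hx.le hK0
      _ < δ := by
          rw [hr, mul_div_assoc']
          rw [div_lt_iff₀ (by linarith)]
          nlinarith
  -- radii in the time variable
  have hsδ : ∀ p : Fin H.lieDim, ∃ rp > (0 : ℝ), ∀ s ∈ ball (0 : ℝ) rp,
      ‖s • ((H.lieBasis p : H.lie.toSubmodule) : Matrix N N A)‖ < δ := by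
    intro p
    set B : ℝ := ‖((H.lieBasis p : H.lie.toSubmodule) : Matrix N N A)‖ with hB
    refine ⟨δ / (B + 1), div_pos hδ0 (by positivity), fun s hs ↦ ?_⟩
    rw [mem_ball_zero_iff, Real.norm_eq_abs] at hs
    calc ‖s • ((H.lieBasis p : H.lie.toSubmodule) : Matrix N N A)‖ = |s| * B := by
          rw [norm_smul, Real.norm_eq_abs]
      _ ≤ δ / (B + 1) * B := mul_le_mul_of_nonneg_right hs.le (norm_nonneg _)
      _ < δ := by
          rw [div_mul_eq_mul_div, div_lt_iff₀ (by positivity)]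
          nlinarith [norm_nonneg ((H.lieBasis p : H.lie.toSubmodule) : Matrix N N A)]
  refine ⟨r, hr0, fun p ↦ ?_, fun p ψ hψ x hx ↦ ?_⟩
  · -- (i) smoothness of the frame
    obtain ⟨rp, hrp, hsp⟩ := hsδ p
    have hF : ContDiffOn ℝ ∞ (H.chartFlow p) (ball 0 r ×ˢ ball 0 rp) := by
      intro z hz
      refine (H.contDiffAt_chartFlow p ?_).contDiffWithinAt
      exact (h2' _ _ (hxδ z.1 hz.1) (hsp z.2 hz.2)).2
    have hopen : IsOpen (ball (0 : Fin H.lieDim → ℝ) r ×ˢ ball (0 : ℝ) rp) :=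
      isOpen_ball.prod isOpen_ball
    have hF' : ContDiffOn ℝ ∞ (fderiv ℝ (H.chartFlow p)) (ball 0 r ×ˢ ball 0 rp) :=
      hF.fderiv_of_isOpen hopen (by simp)
    -- `V_p x = D Φ_p (x, 0) (0, 1)` on the ball
    have hframe : ∀ x ∈ ball (0 : Fin H.lieDim → ℝ) r,
        H.chartFrame p x = fderiv ℝ (H.chartFlow p) (x, 0) ((0 : Fin H.lieDim → ℝ), (1 : ℝ)) := by
      intro x hx
      have hz : (x, (0 : ℝ)) ∈ ball (0 : Fin H.lieDim → ℝ) r ×ˢ ball (0 : ℝ) rp :=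
        ⟨hx, mem_ball_self hrp⟩
      have hd : DifferentiableAt ℝ (H.chartFlow p) (x, 0) :=
        (hF.contDiffAt (hopen.mem_nhds hz)).differentiableAt (by simp)
      have hc : HasDerivAt (fun s : ℝ ↦ (x, s)) ((0 : Fin H.lieDim → ℝ), (1 : ℝ)) 0 :=
        (hasDerivAt_const (0 : ℝ) x).prodMk (hasDerivAt_id (0 : ℝ))
      exact (hd.hasFDerivAt.comp_hasDerivAt (0 : ℝ) hc).deriv
    have hcomp : ContDiffOn ℝ ∞
        (fun x ↦ fderiv ℝ (H.chartFlow p) (x, 0) ((0 : Fin H.lieDim → ℝ), (1 : ℝ))) (ball 0 r) := by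
      have hι : ContDiff ℝ ∞ fun x : Fin H.lieDim → ℝ ↦ (x, (0 : ℝ)) :=
        contDiff_id.prodMk contDiff_const
      have hmaps : MapsTo (fun x : Fin H.lieDim → ℝ ↦ (x, (0 : ℝ))) (ball 0 r)
          (ball 0 r ×ˢ ball 0 rp) := fun x hx ↦ ⟨hx, mem_ball_self hrp⟩
      exact (hF'.comp hι.contDiffOn hmaps).clm_apply contDiffOn_const
    exact hcomp.congr fun x hx ↦ hframe x hx
  · -- (ii) the intertwining identity
    obtain ⟨rp, hrp, hsp⟩ := hsδ p
    have hY : ‖(H.lieCoord x : Matrix N N A)‖ < δ := hxδ x hx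
    set Fψ : (Fin H.lieDim → ℝ) → ℂ := fun y ↦ ψ (H.expCoord y) with hFψ
    -- `Fψ` is smooth
    have hFs : ContDiff ℝ ∞ Fψ := by
      have h := hψ 1
      simp only [MonoidHom.id_apply, one_mul] at h
      exact h.comp (LinearMap.toContinuousLinearMap H.lieCoord.toLinearMap).contDiff
    -- `Φ_p (x, 0) = x`, and `s ↦ Φ_p (x, s)` has derivative `V_p x` at `0`
    have h0 : H.chartFlow p (x, 0) = x := H.chartFlow_zero p (h1' _ hY)
    have hflowd : HasDerivAt (fun s : ℝ ↦ H.chartFlow p (x, s)) (H.chartFrame p x) 0 := by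
      have hz : ContDiffAt ℝ ∞ (H.chartFlow p) (x, 0) := by
        refine H.contDiffAt_chartFlow p ?_
        have := (h2' _ _ hY (hsp 0 (mem_ball_self hrp))).2
        simpa using this
      have hd : DifferentiableAt ℝ (fun s : ℝ ↦ H.chartFlow p (x, s)) 0 :=
        (hz.differentiableAt (by simp)).comp (0 : ℝ)
          ((differentiableAt_const _).prodMk differentiableAt_id)
      exact hd.hasDerivAt
    -- chain rule
    have hchain : HasDerivAt (fun s : ℝ ↦ Fψ (H.chartFlow p (x, s)))
        (fderiv ℝ Fψ x (H.chartFrame p x)) 0 := by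
      have hd : HasFDerivAt Fψ (fderiv ℝ Fψ x) (H.chartFlow p (x, 0)) := by
        rw [h0]
        exact (hFs.differentiable (by simp) x).hasFDerivAt
      exact hd.comp_hasDerivAt (0 : ℝ) hflowd
    -- near `s = 0`, `Fψ (Φ_p (x, s)) = ψ (expCoord x · exp (s b_p))`
    have hev : (fun s : ℝ ↦ Fψ (H.chartFlow p (x, s))) =ᶠ[𝓝 0]
        fun s : ℝ ↦ ψ (H.expCoord x * H.expMem (s • H.lieGen p)) := by
      filter_upwards [ball_mem_nhds (0 : ℝ) hrp] with s hs
      have hp := (h2' _ _ hY (hsp s hs)).1 (H.lieCoord x).2 (Submodule.smul_mem _ _ (H.lieBasis p).2)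
      simp only [hFψ]
      rw [H.expCoord_chartFlow p hp.1 hp.2]
    have hfinal := hchain.congr_of_eventuallyEq hev.symm
    -- the Lie derivative is this derivative
    change fderiv ℝ Fψ x (H.chartFrame p x) =
      deriv (fun t : ℝ ↦ ψ (H.expCoord x * H.expMem (t • H.lieGen p))) 0
    exact hfinal.deriv.symm

/-- **The radius of the exponential chart** (a choice from `exists_chartRadius`). [folklore] -/
def chartRadius : ℝ := Classical.choose H.exists_chartRadius

/-- `0 < chartRadius`. [folklore] -/
theorem chartRadius_pos : 0 < H.chartRadius := (Classical.choose_spec H.exists_chartRadius).1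

/-- The frame is smooth on the chart ball. [folklore] -/
theorem contDiffOn_chartFrame (p : Fin H.lieDim) :
    ContDiffOn ℝ ∞ (H.chartFrame p) (ball 0 H.chartRadius) :=
  (Classical.choose_spec H.exists_chartRadius).2.1 p

/-- **`D(ψ ∘ expCoord)(x)[V_p(x)] = (b_p ψ)(expCoord x)` on the chart ball**, for every `ψ` on
`H` smooth along the exponential. Borel–Jacquet 1979, §1.5; Knapp 2002, I.§10. [cite: Hall2015, Thm. 5.20] -/
theorem fderiv_comp_expCoord_chartFrame (p : Fin H.lieDim) {ψ : H.carrier → ℂ}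
    (hψ : IsArchSmooth (MonoidHom.id H.carrier) ψ) {x : Fin H.lieDim → ℝ}
    (hx : x ∈ ball (0 : Fin H.lieDim → ℝ) H.chartRadius) :
    fderiv ℝ (fun y ↦ ψ (H.expCoord y)) x (H.chartFrame p x) =
      lieDeriv (MonoidHom.id H.carrier) (H.lieGen p) ψ (H.expCoord x) :=
  (Classical.choose_spec H.exists_chartRadius).2.2 p ψ hψ x hx


set_option backward.isDefEq.respectTransparency false in
open scoped Matrix.Norms.Operator in
/-- **The frame at the origin is the coordinate basis**: `V_p(0) = e_p` (`log (exp (s b_p)) = s b_p`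
for small `s`). [folklore] -/
theorem chartFrame_zero (p : Fin H.lieDim) : H.chartFrame p 0 = Pi.single p 1 := by
  have hleft : ∀ᶠ Y in 𝓝 (0 : Matrix N N A), localLog (NormedSpace.exp Y) = Y :=
    HasStrictFDerivAt.eventually_left_inverse _
  -- `s b_p → 0` as `s → 0`
  have ht : Tendsto (fun s : ℝ ↦ s • ((H.lieBasis p : H.lie.toSubmodule) : Matrix N N A)) (𝓝 0)
      (𝓝 0) := by
    have : Tendsto (fun s : ℝ ↦ s • ((H.lieBasis p : H.lie.toSubmodule) : Matrix N N A)) (𝓝 0)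
        (𝓝 ((0 : ℝ) • ((H.lieBasis p : H.lie.toSubmodule) : Matrix N N A))) :=
      tendsto_id.smul tendsto_const_nhds
    rwa [zero_smul] at this
  have hev : (fun s : ℝ ↦ H.chartFlow p (0, s)) =ᶠ[𝓝 0] fun s : ℝ ↦ s • Pi.single p 1 := by
    filter_upwards [ht.eventually hleft] with s hs
    have hmem : s • ((H.lieBasis p : H.lie.toSubmodule) : Matrix N N A) ∈ H.lie.toSubmodule :=
      Submodule.smul_mem _ _ (H.lieBasis p).2
    have hret : H.lieRetract (s • ((H.lieBasis p : H.lie.toSubmodule) : Matrix N N A)) =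
        s • H.lieBasis p := by
      have := H.lieRetract_apply_coe (s • H.lieBasis p)
      rwa [Submodule.coe_smul] at this
    change H.lieCoord.symm (H.lieRetract (localLog (NormedSpace.exp ((H.lieCoord 0 : Matrix N N A)) *
      NormedSpace.exp (s • ((H.lieBasis p : H.lie.toSubmodule) : Matrix N N A))))) = s • Pi.single p 1
    rw [map_zero, ZeroMemClass.coe_zero, NormedSpace.exp_zero, one_mul, hs, hret, map_smul,
      ← H.lieCoord_single p, LinearEquiv.symm_apply_apply]
  rw [chartFrame, hev.deriv_eq]
  have hd : HasDerivAt (fun s : ℝ ↦ s • (Pi.single p 1 : Fin H.lieDim → ℝ))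
      (Pi.single p 1 : Fin H.lieDim → ℝ) 0 := by
    simpa using (hasDerivAt_id (0 : ℝ)).smul_const (Pi.single p 1 : Fin H.lieDim → ℝ)
  exact hd.deriv

/-! ### Words in the frame and iterated Lie derivatives -/

/-- The derivative along the frame field `V_p`: `(V_p F)(x) = DF(x)[V_p(x)]`. [folklore] -/
def frameDeriv (p : Fin H.lieDim) (F : (Fin H.lieDim → ℝ) → ℂ) (x : Fin H.lieDim → ℝ) : ℂ :=
  fderiv ℝ F x (H.chartFrame p x)

/-- The word `V_{p₁} (V_{p₂} (⋯ (V_{pₖ} F)))` of frame derivatives of a list `[p₁, …, pₖ]`.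
[folklore] -/
def frameWord : List (Fin H.lieDim) → ((Fin H.lieDim → ℝ) → ℂ) → ((Fin H.lieDim → ℝ) → ℂ)
  | [], F => F
  | p :: l, F => H.frameDeriv p (frameWord l F)

/-- `frameWord [] F = F`. [folklore] -/
@[simp] theorem frameWord_nil (F : (Fin H.lieDim → ℝ) → ℂ) : H.frameWord [] F = F := rfl

/-- `frameWord (p :: l) F = V_p (frameWord l F)`. [folklore] -/
@[simp] theorem frameWord_cons (p : Fin H.lieDim) (l : List (Fin H.lieDim))
    (F : (Fin H.lieDim → ℝ) → ℂ) : H.frameWord (p :: l) F = H.frameDeriv p (H.frameWord l F) := rfl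

/-- Iterated Lie derivatives of a function smooth along the exponential are smooth along the
exponential (every linear real group, finite-dimensional coefficients).
Borel–Jacquet 1979, §1.5. [cite: BorelJacquetCorvallis1979, §1.5] -/
theorem isArchSmooth_iterLieDeriv_of_isArchSmooth {G : Type*} [Group G] (ι : H.carrier →* G)
    (w : List H.lie) {φ : G → ℂ} (hφ : IsArchSmooth ι φ) : IsArchSmooth ι (iterLieDeriv ι w φ) := by
  induction w with
  | nil => simpa using hφ
  | cons X w ih => simpa using isArchSmooth_lieDeriv_of_isArchSmooth ι X ih

/-- **Words in the frame are chart expressions of iterated Lie derivatives**: on the chart ball,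
`V_{p₁} ⋯ V_{pₖ} (ψ ∘ expCoord) = (b_{p₁} ⋯ b_{pₖ} ψ) ∘ expCoord` for `ψ` smooth along the
exponential. Borel–Jacquet 1979, §1.5; Knapp 2002, I.§10. [cite: Hall2015, Thm. 5.20] -/
theorem frameWord_comp_expCoord_eqOn (l : List (Fin H.lieDim)) {ψ : H.carrier → ℂ}
    (hψ : IsArchSmooth (MonoidHom.id H.carrier) ψ) :
    EqOn (H.frameWord l fun y ↦ ψ (H.expCoord y))
      (fun y ↦ iterLieDeriv (MonoidHom.id H.carrier) (l.map H.lieGen) ψ (H.expCoord y))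
      (ball 0 H.chartRadius) := by
  induction l with
  | nil => intro x _; rfl
  | cons p l ih =>
    intro x hx
    have hψ' : IsArchSmooth (MonoidHom.id H.carrier)
        (iterLieDeriv (MonoidHom.id H.carrier) (l.map H.lieGen) ψ) :=
      H.isArchSmooth_iterLieDeriv_of_isArchSmooth _ _ hψ
    have hev : (H.frameWord l fun y ↦ ψ (H.expCoord y)) =ᶠ[𝓝 x]
        fun y ↦ iterLieDeriv (MonoidHom.id H.carrier) (l.map H.lieGen) ψ (H.expCoord y) :=
      ih.eventuallyEq_of_mem (isOpen_ball.mem_nhds hx)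
    simp only [frameWord_cons, frameDeriv, List.map_cons, iterLieDeriv_cons]
    rw [hev.fderiv_eq]
    exact H.fderiv_comp_expCoord_chartFrame p hψ' hx

/-! ### Base points: functions `h ↦ ψ (g · ι h)` -/

/-- The right-translated pull-back `ψ_g (h) = ψ (g · ι h)` of `ψ : G → ℂ` to `H`. [folklore] -/
def pullAt {G : Type*} [Group G] (ι : H.carrier →* G) (g : G) (ψ : G → ℂ) : H.carrier → ℂ :=
  fun h ↦ ψ (g * ι h)

omit [FiniteDimensional ℝ A] in
/-- `pullAt ι g ψ h = ψ (g ι h)`. [folklore] -/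
@[simp] theorem pullAt_apply {G : Type*} [Group G] (ι : H.carrier →* G) (g : G) (ψ : G → ℂ)
    (h : H.carrier) : H.pullAt ι g ψ h = ψ (g * ι h) := rfl

omit [FiniteDimensional ℝ A] in
set_option backward.isDefEq.respectTransparency false in
open scoped Matrix.Norms.Operator in
/-- `ψ_g` is smooth along the exponential of `H` when `ψ` is (with respect to `ι`). [folklore] -/
theorem isArchSmooth_pullAt {G : Type*} [Group G] (ι : H.carrier →* G) (g : G) {ψ : G → ℂ}
    (hψ : IsArchSmooth ι ψ) : IsArchSmooth (MonoidHom.id H.carrier) (H.pullAt ι g ψ) := by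
  intro h
  have := hψ (g * ι h)
  simpa only [pullAt, MonoidHom.id_apply, map_mul, mul_assoc] using this

omit [FiniteDimensional ℝ A] in
/-- Lie derivatives commute with the pull-back: `(X ψ_g)(h) = (X ψ)(g ι h)`. [folklore] -/
theorem lieDeriv_pullAt {G : Type*} [Group G] (ι : H.carrier →* G) (g : G) (X : H.lie)
    (ψ : G → ℂ) :
    lieDeriv (MonoidHom.id H.carrier) X (H.pullAt ι g ψ) = H.pullAt ι g (lieDeriv ι X ψ) := by
  funext h
  simp only [lieDeriv, pullAt, MonoidHom.id_apply, map_mul, mul_assoc]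

omit [FiniteDimensional ℝ A] in
/-- Iterated Lie derivatives commute with the pull-back. [folklore] -/
theorem iterLieDeriv_pullAt {G : Type*} [Group G] (ι : H.carrier →* G) (g : G) (w : List H.lie)
    (ψ : G → ℂ) :
    iterLieDeriv (MonoidHom.id H.carrier) w (H.pullAt ι g ψ) = H.pullAt ι g (iterLieDeriv ι w ψ) := by
  induction w with
  | nil => rfl
  | cons X w ih => simp only [iterLieDeriv_cons, ih, lieDeriv_pullAt]

/-- **Words in the frame at a base point**: on the chart ball,
`V_{p₁} ⋯ V_{pₖ} (x ↦ ψ (g ι(expCoord x))) = x ↦ (b_{p₁} ⋯ b_{pₖ} ψ)(g ι(expCoord x))` for `ψ`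
smooth in the archimedean variable. This is the form consumed by the `L²`-analysis of the
sequel. Borel–Jacquet 1979, §1.5. [cite: Hall2015, Thm. 5.20] -/
theorem frameWord_pullAt_eqOn {G : Type*} [Group G] (ι : H.carrier →* G) (g : G)
    (l : List (Fin H.lieDim)) {ψ : G → ℂ} (hψ : IsArchSmooth ι ψ) :
    EqOn (H.frameWord l fun y ↦ ψ (g * ι (H.expCoord y)))
      (fun y ↦ iterLieDeriv ι (l.map H.lieGen) ψ (g * ι (H.expCoord y)))
      (ball 0 H.chartRadius) := by
  have h := H.frameWord_comp_expCoord_eqOn l (H.isArchSmooth_pullAt ι g hψ)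
  intro x hx
  have h1 := h hx
  simp only [pullAt] at h1
  rw [iterLieDeriv_pullAt] at h1
  exact h1

end RealMatrixGroup

end Literature.NumberTheory.Automorphic
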